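/-
Copyright (c) 2026 the pub-hodgecm-mathlib formalisation cell (harness21).  Prover seat hodgecm-mathlib-K2E4-p23 (g2), Track B ∕ K2-LIT, h413 =
`stmt-HodgeConjecture-24833`, ENGINE E1, 5Res campaign «ENDGAME BY FAMILIES», ROADCARD §3′ amendment #2 (228) of K2E1-plan (g7): (S1) Hecke-module irreducibility of a
K-type block of an irreducible representation + (S3) Schur for the compressed operator family.  Abstract; Mathlib + ★ Literature (`HilbertRepSchur`, `HilbertRepSpectrum`).
-/
import Literature.NumberTheory.Automorphic.HilbertRepSchur      -- ★ `IsIrreducibleFamily`, `IsIrreducibleFamily.exists_eq_algebraMap` (family Schur); brings `ClosedSubrep`, `IsTopIrreducible`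
import Mathlib.Topology.Algebra.Module.ContinuousLinearMap.Restrict
import HarnessLib

/-!
# K2·E1 — `K2E1HeckeModuleIrreducibleSchurU`: THE `P𝓐P`-MODULE `range P` OF AN IRREDUCIBLE REPRESENTATION IS TOPOLOGICALLY IRREDUCIBLE (S1), AND AN OPERATOR COMMUTING WITH
# `𝓐` AND `P` IS A SCALAR ON IT (S3) (ROADCARD §3′ amendment #2 (228): «an irreducible has an arch Hecke eigenvalue», bounded operators only)

Track B ∕ K2-LIT, crux h413 = `stmt-HodgeConjecture-24833`, route of record `HCCMUnconditional`; cell `hodgecm-mathlib`, squad K2, ENGINE E1 (5Res campaign, M2 v2 §3′.1 (ii′)).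
Prover seat `hodgecm-mathlib-K2E4-p23` (g2); deal (228).  THEOREMS ONLY (no `def`, no `instance`, no notation, no named-fact hypothesis, no `sorry`); lane
`--supports stmt-HodgeConjecture-24833 --as helper` (count-neutral).  Abstract representation theory — no automorphic object.  CLOSES NO SOCKET.

SETTING (integration-free, so that ★ F2a's `integratedOperator` instantiates it by name).  `π : ContRepresentation ℂ G H` TOPOLOGICALLY IRREDUCIBLE on a Hilbert space; the «Hecke
algebra» is an abstract operator set `𝓐 ⊆ H →L[ℂ] H` (E1: `{R(f) : f ∈ C_c(G(𝔸))}`) with (A1) `h𝓐 : π g ∘ A ∈ 𝓐` (E1: `R(g)R(f) = R(λ_g f)`), (A2) non-degeneracy `hnd : (∀ A ∈ 𝓐, A v = 0) → v = 0`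
(E1: approximate identities), (A3, for S3) `hstar : A† ∈ 𝓐` (E1: `R(f)† = R(f*)`); the «K-type projector» is an abstract `P : H →L H` onto a closed subspace `V` (`hPV : P x ∈ V`,
`hPid : P v = v` on `V`, `hPsa : ⟪Px, y⟫ = ⟪x, Py⟫`; E1: `P = R(e_τ ⊗ e_{K′_f})`, `V = π^{(τ,K′_f)}`).
* §1 **(S1) `eq_bot_or_eq_range_of_compression_stable`**: a closed `W′ ≤ range P` stable under every `P A` (`A ∈ 𝓐`) is `⊥` or `range P` — `S := closure span 𝓐W′` is a closed
  subrepresentation (A1), hence `⊥` (then `W′ = 0` by A2) or `⊤` (then `range P = P S ≤ W′`).  Unitarity is NOT needed.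
* §2 `isIrreducibleFamily_compression`: the compressions `B_A = P A|_V : V →L V` form an irreducible family on `V` (★ `IsIrreducibleFamily`); `adjoint_compression`: `B_A† = B_{A†}`.
* §3 **(S3) `exists_apply_eq_smul_of_commute`**: `T` commuting with `𝓐` and with `P` acts on `V` by a scalar (`T|_V` commutes with the `*`-closed irreducible family `{B_A}`; ★
  `IsIrreducibleFamily.exists_eq_algebraMap`).  E1 reading: `R(h_∞ ⊗ e_{K′}) v = λ_h(π) · v` on `π^{(τ,K′_f)}` — step (ii′) of §3′.1.  ED. 2: **`exists_apply_eq_smul_of_commute_compression`**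
  — the same with the honest hypothesis «`T|_V` commutes with the compressions `P A|_V`» ((S2) shape).
HONEST LABEL: HC_CM is proved only modulo the 7 printed citations (2 remaining named inputs: hLiu418 = `stmt-HodgeConjecture-24832`, h413 = `stmt-HodgeConjecture-24833`) until rung 0
closes; this file asserts no named fact and closes no socket; count-neutral.

## References
* [DeitmarEchterhoff2014] A. Deitmar, S. Echterhoff, *Principles of Harmonic Analysis* (2nd ed., 2014), Thm. 5.1.6, Lemma 6.1.7 (Schur for operator families).
* [Knapp1986] A. W. Knapp, *Representation Theory of Semisimple Groups* (1986), VIII §3 (irreducible `(𝔤,K)`∕Hecke modules of `K`-types of irreducibles).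
* [MoeglinWaldspurger1995] C. Mœglin, J.-L. Waldspurger (1995), IV.3.12, VI.2.
-/

set_option autoImplicit false
-- the mandated namespace repeats the single-problem summit's segment (`HodgeConjecture.HodgeConjecture`)
set_option linter.dupNamespace false

noncomputable section

open ContRepresentation Set
open scoped InnerProductSpace
open Literature.NumberTheory.Automorphic (IsIrreducibleFamily)

namespace Summit.HodgeConjecture.HodgeConjecture.Cruxes.H413.K2E1HeckeModuleIrreducibleSchurU

variable {G H : Type*} [Group G] [NormedAddCommGroup H] [InnerProductSpace ℂ H] {π : ContRepresentation ℂ G H}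

/-! ## §1 (S1) Hecke-module irreducibility of a compressed block -/

/-- **(S1) A CLOSED `P𝓐`-STABLE SUBSPACE OF `range P` IS `⊥` OR `range P`** when `π` is topologically irreducible, `𝓐` is stable under left multiplication by the `π g` and non-degenerate.
PROOF: `S := closure span {A w : A ∈ 𝓐, w ∈ W′}` is a closed subrepresentation (A1 + continuity), so `S = ⊥` (then `𝓐` kills `W′`, `W′ = 0` by A2) or `S = ⊤` (then
`range P = P(S) ⊆ closure P(span 𝓐W′) ⊆ W′`). [cite: Knapp1986, VIII §3] [cite: DeitmarEchterhoff2014, Thm. 5.1.6] -/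
theorem eq_bot_or_eq_range_of_compression_stable (hirr : π.IsTopIrreducible) {𝓐 : Set (H →L[ℂ] H)}
    (h𝓐 : ∀ (g : G), ∀ A ∈ 𝓐, (π g).comp A ∈ 𝓐) (hnd : ∀ v : H, (∀ A ∈ 𝓐, A v = 0) → v = 0) (P : H →L[ℂ] H)
    (W' : Submodule ℂ H) (hW'c : IsClosed (W' : Set H)) (hW'P : W' ≤ LinearMap.range (P : H →ₗ[ℂ] H))
    (hstab : ∀ A ∈ 𝓐, ∀ w ∈ W', P (A w) ∈ W') :
    W' = ⊥ ∨ W' = LinearMap.range (P : H →ₗ[ℂ] H) := by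
  -- the span of `𝓐 W′` and its closure, a closed subrepresentation
  set gen : Set H := {x : H | ∃ A ∈ 𝓐, ∃ w ∈ W', x = A w} with hgen
  set S₀ : Submodule ℂ H := Submodule.span ℂ gen with hS₀
  have hS₀inv : ∀ g : G, ∀ x ∈ S₀, π g x ∈ S₀ := by
    intro g x hx
    have hle : S₀ ≤ S₀.comap (π g : H →ₗ[ℂ] H) := by
      rw [hS₀, Submodule.span_le]
      rintro _ ⟨A, hA, w, hw, rfl⟩
      exact Submodule.mem_comap.2 (Submodule.subset_span ⟨(π g).comp A, h𝓐 g A hA, w, hw, rfl⟩)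
    exact hle hx
  let S : ClosedSubrep π :=
    { toSubmodule := S₀.topologicalClosure
      apply_mem_toSubmodule := fun g v hv => by
        have hmaps : Set.MapsTo (π g) (S₀ : Set H) (S₀ : Set H) := fun x hx => hS₀inv g x hx
        have hcl := hmaps.closure (π g).continuous
        rw [← Submodule.topologicalClosure_coe] at hcl
        exact hcl hv
      isClosed' := Submodule.isClosed_topologicalClosure _ }
  rcases ((isTopIrreducible_iff π).1 hirr).2 S with hS | hS
  · -- `S = ⊥`: every `A w` vanishes, so `W′ = 0` by non-degeneracy
    left
    rw [eq_bot_iff]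
    intro w hw
    rw [Submodule.mem_bot]
    refine hnd w fun A hA => ?_
    have hmem : A w ∈ S := Submodule.le_topologicalClosure _ (Submodule.subset_span ⟨A, hA, w, hw, rfl⟩)
    rw [hS, ClosedSubrep.mem_bot] at hmem
    exact hmem
  · -- `S = ⊤`: `range P = P(S) ⊆ W′`
    right
    refine le_antisymm hW'P ?_
    rintro _ ⟨y, rfl⟩
    have hy : y ∈ S := by rw [hS]; exact ClosedSubrep.mem_top y
    -- `P` maps the span into `W′`, hence its closure into `closure W′ = W′`
    have hspan : Set.MapsTo P (S₀ : Set H) (W' : Set H) := by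
      intro x hx
      refine Submodule.span_induction (p := fun x _ => P x ∈ W') ?_ ?_ ?_ ?_ hx
      · rintro _ ⟨A, hA, w, hw, rfl⟩
        exact hstab A hA w hw
      · rw [map_zero]; exact W'.zero_mem
      · intro a b _ _ ha hb
        rw [map_add]; exact W'.add_mem ha hb
      · intro c a _ ha
        rw [map_smul]; exact W'.smul_mem c ha
    have hcl := hspan.closure P.continuous
    rw [← Submodule.topologicalClosure_coe, hW'c.closure_eq] at hcl
    exact hcl hy

/-! ## §2 The compressed family on `V = range P` is irreducible and `*`-closed -/

/-- `range P = V` for a projection onto `V` (`P x ∈ V`, `P v = v` on `V`). [folklore] -/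
theorem range_eq_of_proj (P : H →L[ℂ] H) (V : Submodule ℂ H) (hPV : ∀ x, P x ∈ V) (hPid : ∀ v ∈ V, P v = v) :
    LinearMap.range (P : H →ₗ[ℂ] H) = V := by
  refine le_antisymm ?_ fun v hv => ⟨v, hPid v hv⟩
  rintro _ ⟨x, rfl⟩
  exact hPV x

/-- **THE COMPRESSIONS `B_A = P A|_V` ACT IRREDUCIBLY ON `V`** (★ `IsIrreducibleFamily`): a closed `{B_A}`-stable `K ≤ V` gives the closed `P𝓐`-stable `W′ = K ⊆ range P`, which is `⊥` or
`range P` by §1. [cite: Knapp1986, VIII §3] [cite: DeitmarEchterhoff2014, Thm. 5.1.6] -/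
theorem isIrreducibleFamily_compression (hirr : π.IsTopIrreducible) {𝓐 : Set (H →L[ℂ] H)}
    (h𝓐 : ∀ (g : G), ∀ A ∈ 𝓐, (π g).comp A ∈ 𝓐) (hnd : ∀ v : H, (∀ A ∈ 𝓐, A v = 0) → v = 0)
    (V : Submodule ℂ H) (hVc : IsClosed (V : Set H)) (P : H →L[ℂ] H) (hPV : ∀ x, P x ∈ V) (hPid : ∀ v ∈ V, P v = v) :
    IsIrreducibleFamily {B : V →L[ℂ] V | ∃ A ∈ 𝓐, B = (P.comp (A.comp V.subtypeL)).codRestrict V fun x => hPV (A (x : H))} := by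
  intro K hKc hKinv
  set W' : Submodule ℂ H := K.map V.subtype with hW'
  have hW'c : IsClosed (W' : Set H) := by
    have hc : (W' : Set H) = Subtype.val '' (K : Set V) := Submodule.map_coe _ _
    rw [hc]
    exact hKc.trans hVc
  have hW'V : W' ≤ V := by
    rintro _ ⟨k, -, rfl⟩
    exact k.2
  have hW'P : W' ≤ LinearMap.range (P : H →ₗ[ℂ] H) := by rw [range_eq_of_proj P V hPV hPid]; exact hW'V
  have hstab : ∀ A ∈ 𝓐, ∀ w ∈ W', P (A w) ∈ W' := by
    rintro A hA _ ⟨k, hk, rfl⟩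
    refine ⟨(P.comp (A.comp V.subtypeL)).codRestrict V (fun x => hPV (A (x : H))) k, hKinv _ ⟨A, hA, rfl⟩ k hk, ?_⟩
    rfl
  rcases eq_bot_or_eq_range_of_compression_stable hirr h𝓐 hnd P W' hW'c hW'P hstab with h | h
  · left
    rw [hW', ← Submodule.map_bot V.subtype] at h
    exact Submodule.map_injective_of_injective (Submodule.injective_subtype V) h
  · right
    rw [hW', range_eq_of_proj P V hPV hPid] at h
    have h2 : K.map V.subtype = (⊤ : Submodule ℂ V).map V.subtype := by rw [Submodule.map_subtype_top]; exact h
    exact Submodule.map_injective_of_injective (Submodule.injective_subtype V) h2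

/-- **`B_A† = B_{A†}`** for the compressions by a SYMMETRIC `P` onto `V`. [folklore] -/
theorem adjoint_compression [CompleteSpace H] (V : Submodule ℂ H) (hVc : IsClosed (V : Set H)) (P : H →L[ℂ] H) (hPV : ∀ x, P x ∈ V) (hPid : ∀ v ∈ V, P v = v)
    (hPsa : ∀ x y : H, ⟪P x, y⟫_ℂ = ⟪x, P y⟫_ℂ) (A : H →L[ℂ] H) :
    haveI : CompleteSpace V := hVc.completeSpace_coe
    ContinuousLinearMap.adjoint ((P.comp (A.comp V.subtypeL)).codRestrict V fun x => hPV (A (x : H))) =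
      (P.comp ((ContinuousLinearMap.adjoint A).comp V.subtypeL)).codRestrict V fun x => hPV (ContinuousLinearMap.adjoint A (x : H)) := by
  haveI : CompleteSpace V := hVc.completeSpace_coe
  symm
  rw [ContinuousLinearMap.eq_adjoint_iff]
  intro x y
  rw [Submodule.coe_inner, Submodule.coe_inner, ContinuousLinearMap.coe_codRestrict_apply, ContinuousLinearMap.coe_codRestrict_apply]
  change ⟪P (ContinuousLinearMap.adjoint A (x : H)), (y : H)⟫_ℂ = ⟪(x : H), P (A (y : H))⟫_ℂ
  rw [hPsa, hPid _ y.2, ContinuousLinearMap.adjoint_inner_left, ← hPsa, hPid _ x.2]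

/-! ## §3 (S3) Schur: an operator commuting with `𝓐` and `P` is a scalar on `V` -/

/-- **(S3) SCHUR ON A K-TYPE BLOCK**: `π` topologically irreducible, `𝓐` as in (A1)–(A3), `P` a symmetric projection onto the closed `V`; a bounded `T` commuting with every `A ∈ 𝓐` and
with `P` acts on `V` by a scalar: `∃ c, ∀ v ∈ V, T v = c • v`.  (`T|_V` commutes with the `*`-closed irreducible family `{P A|_V}` of §2; ★ `IsIrreducibleFamily.exists_eq_algebraMap`.)
E1: `R(h) v = λ_h(π) • v` on `π^{(τ,K′_f)}` for `h = h_∞ ⊗ e_{K′_f}` commuting with `R(C_c)`-compressions and with `R(e)`. [cite: DeitmarEchterhoff2014, Lemma 6.1.7] [cite: MoeglinWaldspurger1995, IV.3.12] -/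
theorem exists_apply_eq_smul_of_commute [CompleteSpace H] (hirr : π.IsTopIrreducible) {𝓐 : Set (H →L[ℂ] H)}
    (h𝓐 : ∀ (g : G), ∀ A ∈ 𝓐, (π g).comp A ∈ 𝓐) (hnd : ∀ v : H, (∀ A ∈ 𝓐, A v = 0) → v = 0)
    (hstar : ∀ A ∈ 𝓐, ContinuousLinearMap.adjoint A ∈ 𝓐)
    (V : Submodule ℂ H) (hVc : IsClosed (V : Set H)) (P : H →L[ℂ] H) (hPV : ∀ x, P x ∈ V) (hPid : ∀ v ∈ V, P v = v)
    (hPsa : ∀ x y : H, ⟪P x, y⟫_ℂ = ⟪x, P y⟫_ℂ)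
    (T : H →L[ℂ] H) (hTA : ∀ A ∈ 𝓐, Commute A T) (hTP : Commute P T) :
    ∃ c : ℂ, ∀ v ∈ V, T v = c • v := by
  haveI : CompleteSpace V := hVc.completeSpace_coe
  have hTV : ∀ x : V, T (x : H) ∈ V := fun x => by
    have h := congrArg (fun S : H →L[ℂ] H => S (x : H)) hTP.eq
    change P (T (x : H)) = T (P (x : H)) at h
    rw [hPid _ x.2] at h
    rw [← h]
    exact hPV _
  set TV : V →L[ℂ] V := (T.comp V.subtypeL).codRestrict V hTV with hTVdef
  have hfam := isIrreducibleFamily_compression hirr h𝓐 hnd V hVc P hPV hPid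
  have hstarfam : ∀ S ∈ {B : V →L[ℂ] V | ∃ A ∈ 𝓐, B = (P.comp (A.comp V.subtypeL)).codRestrict V fun x => hPV (A (x : H))},
      ContinuousLinearMap.adjoint S ∈ {B : V →L[ℂ] V | ∃ A ∈ 𝓐, B = (P.comp (A.comp V.subtypeL)).codRestrict V fun x => hPV (A (x : H))} := by
    rintro _ ⟨A, hA, rfl⟩
    exact ⟨ContinuousLinearMap.adjoint A, hstar A hA, adjoint_compression V hVc P hPV hPid hPsa A⟩
  have hcomm : ∀ S ∈ {B : V →L[ℂ] V | ∃ A ∈ 𝓐, B = (P.comp (A.comp V.subtypeL)).codRestrict V fun x => hPV (A (x : H))}, Commute S TV := by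
    rintro _ ⟨A, hA, rfl⟩
    apply ContinuousLinearMap.ext
    intro x
    apply Subtype.ext
    change P (A (T (x : H))) = T (P (A (x : H)))
    have h1 := congrArg (fun S : H →L[ℂ] H => S (x : H)) (hTA A hA).eq
    have h2 := congrArg (fun S : H →L[ℂ] H => S (A (x : H))) hTP.eq
    change A (T (x : H)) = T (A (x : H)) at h1
    change P (T (A (x : H))) = T (P (A (x : H))) at h2
    rw [h1, h2]
  obtain ⟨c, hc⟩ := hfam.exists_eq_algebraMap hstarfam hcomm
  refine ⟨c, fun v hv => ?_⟩
  have h := congrArg (fun S : V →L[ℂ] V => ((S ⟨v, hv⟩ : V) : H)) hc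
  simp only [ContinuousLinearMap.algebraMap_apply, Submodule.coe_smul] at h
  rw [← h]
  rfl

/-- **(S3), COMPRESSION EDITION (ED. 2 — the honest E1 hypothesis, ROADCARD (234))**: it suffices that `T` preserve `V` and that `T|_V` commute with the COMPRESSIONS `P A|_V`
(`P (A (T x)) = T (P (A x))` for `x ∈ V`, `A ∈ 𝓐`) — in E1, `R(h)` does NOT commute with all of `R(C_c)`, but on the `(τ,K′)`-block both `U R(h) U*` and `U (P R(f) P) U*` are
multiplications in the model, so they commute ((S2) of amendment #2). Conclusion as in (S3): `∃ c, ∀ v ∈ V, T v = c • v`. [cite: DeitmarEchterhoff2014, Lemma 6.1.7] -/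
theorem exists_apply_eq_smul_of_commute_compression [CompleteSpace H] (hirr : π.IsTopIrreducible) {𝓐 : Set (H →L[ℂ] H)}
    (h𝓐 : ∀ (g : G), ∀ A ∈ 𝓐, (π g).comp A ∈ 𝓐) (hnd : ∀ v : H, (∀ A ∈ 𝓐, A v = 0) → v = 0)
    (hstar : ∀ A ∈ 𝓐, ContinuousLinearMap.adjoint A ∈ 𝓐)
    (V : Submodule ℂ H) (hVc : IsClosed (V : Set H)) (P : H →L[ℂ] H) (hPV : ∀ x, P x ∈ V) (hPid : ∀ v ∈ V, P v = v)
    (hPsa : ∀ x y : H, ⟪P x, y⟫_ℂ = ⟪x, P y⟫_ℂ)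
    (T : H →L[ℂ] H) (hTV : ∀ x ∈ V, T x ∈ V) (hTB : ∀ A ∈ 𝓐, ∀ x ∈ V, P (A (T x)) = T (P (A x))) :
    ∃ c : ℂ, ∀ v ∈ V, T v = c • v := by
  haveI : CompleteSpace V := hVc.completeSpace_coe
  set TV : V →L[ℂ] V := (T.comp V.subtypeL).codRestrict V (fun x => hTV _ x.2) with hTVdef
  have hfam := isIrreducibleFamily_compression hirr h𝓐 hnd V hVc P hPV hPid
  have hstarfam : ∀ S ∈ {B : V →L[ℂ] V | ∃ A ∈ 𝓐, B = (P.comp (A.comp V.subtypeL)).codRestrict V fun x => hPV (A (x : H))},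
      ContinuousLinearMap.adjoint S ∈ {B : V →L[ℂ] V | ∃ A ∈ 𝓐, B = (P.comp (A.comp V.subtypeL)).codRestrict V fun x => hPV (A (x : H))} := by
    rintro _ ⟨A, hA, rfl⟩
    exact ⟨ContinuousLinearMap.adjoint A, hstar A hA, adjoint_compression V hVc P hPV hPid hPsa A⟩
  have hcomm : ∀ S ∈ {B : V →L[ℂ] V | ∃ A ∈ 𝓐, B = (P.comp (A.comp V.subtypeL)).codRestrict V fun x => hPV (A (x : H))}, Commute S TV := by
    rintro _ ⟨A, hA, rfl⟩
    apply ContinuousLinearMap.ext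
    intro x
    apply Subtype.ext
    exact hTB A hA (x : H) x.2
  obtain ⟨c, hc⟩ := hfam.exists_eq_algebraMap hstarfam hcomm
  refine ⟨c, fun v hv => ?_⟩
  have h := congrArg (fun S : V →L[ℂ] V => ((S ⟨v, hv⟩ : V) : H)) hc
  simp only [ContinuousLinearMap.algebraMap_apply, Submodule.coe_smul] at h
  rw [← h]
  rfl

end Summit.HodgeConjecture.HodgeConjecture.Cruxes.H413.K2E1HeckeModuleIrreducibleSchurU

end
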